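import Mathlib
import HarnessLib
import Summits.NavierStokesRegularity.NavierStokesRegularity.Theorems.PoloidalWindowRigidity.Negative.ResidueFalseWithClassRates

/-!
# Crux `PoloidalWindowRigidity` (K2, stmt-NavierStokesRegularity-19708) — negative side:
# the negative-lane witnesses are COMPLEX-LAMELLAR (helicity-free)

Negative-side support (refuter seat ns-regularity-refuter1, cell ns-regularity-ideate; D-0081 §C), a cross-door
remark on the witnesses of `…Negative.CellField` / `…Negative.DriftProfile`:

* `helicityFree_cellProfile`, `helicityFree_driftProfile`: the separated cellular profile `c(t)V(x)` and the drifting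
  discretely self-similar cellular profile `w` satisfy `⟪v(s,y), curl v(s)(y)⟫ = 0` for every `s, y` — their velocity
  is everywhere orthogonal to their (horizontal) vorticity. (For a poloidal field with horizontal vorticity
  `ω = (ω₀, ω₁, 0)` one has `v·ω = v₀ω₀ + v₁ω₁`, and for the cellular field this is
  `2 sin x₂ cos x₂ (cos x₀ cos x₁ − cos x₁ cos x₀) = 0`.)

Consequences (bookkeeping, no claim about Navier–Stokes): (i) no exclusion hypothesis of the K2 residue S2′ phrased as
«the helicity density does not vanish identically» is available against these witnesses; (ii) the witnesses lie in the
residue class 𝔉 = {Type-I profiles with `v·curl v ≡ 0`} of the helicity door (route `LocalTubeDoorHelicity`, crux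
K2⁗ `FrobeniusProfileRigidity`) minus its Oseen-mild clause, so that door's slice classification inherits the K2
negative lane: by `vorticityDirection_nonconstant_driftProfile` and `not_translationInvariant_driftProfile` no slice of
`w` is vorticity-aligned or translation-invariant along a line. [folklore]
-/

noncomputable section

namespace Summit.NavierStokesRegularity.NavierStokesRegularity.Theorems.PoloidalWindowRigidity.Negative

open Set Function
open scoped RealInnerProductSpace InnerProductSpace
open Literature.Analysis Literature.Analysis.FluidPDE

/-- **The drifting cellular profile is helicity-free**: `⟪w(s,y), curl w(s)(y)⟫ = 0`. [folklore] -/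
theorem helicityFree_driftProfile (s : ℝ) (y : EuclideanSpace ℝ (Fin 3)) :
    ⟪driftProfile s y, curl (driftProfile s) y⟫_ℝ = 0 := by
  have h0 : driftProfile s y 0 = cellAmp s * (Real.cos (driftShift s y 2) * Real.cos (driftShift s y 0)) := by
    simp [driftProfile, cellField_apply_zero]
  have h1 : driftProfile s y 1 = cellAmp s * (Real.cos (driftShift s y 2) * Real.cos (driftShift s y 1)) := by
    simp [driftProfile, cellField_apply_one]
  simp only [PiLp.inner_apply, RCLike.inner_apply, conj_trivial, Fin.sum_univ_three, h0, h1,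
    curl_driftProfile_apply_zero, curl_driftProfile_apply_one, curl_driftProfile_apply_two]
  ring

/-- **The separated cellular profile is helicity-free**: `⟪c(s)V(y), curl (c(s)V)(y)⟫ = 0`. [folklore] -/
theorem helicityFree_cellProfile (s : ℝ) (y : EuclideanSpace ℝ (Fin 3)) :
    ⟪cellProfile s y, curl (cellProfile s) y⟫_ℝ = 0 := by
  have h0 : cellProfile s y 0 = cellAmp s * (Real.cos (y 2) * Real.cos (y 0)) := by
    simp [cellProfile, cellField_apply_zero]
  have h1 : cellProfile s y 1 = cellAmp s * (Real.cos (y 2) * Real.cos (y 1)) := by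
    simp [cellProfile, cellField_apply_one]
  simp only [PiLp.inner_apply, RCLike.inner_apply, conj_trivial, Fin.sum_univ_three, h0, h1,
    curl_cellProfile_apply_zero, curl_cellProfile_apply_one, curl_cellProfile_apply_two]
  ring

/-- The helicity-door shape of the two landed exclusions: no slice of the drifting profile is vorticity-aligned
(alternative (1) of the slice classification) or translation-invariant along a line (alternative (2)). [folklore] -/
theorem driftProfile_no_aligned_no_translationInvariant_slice :
    ¬ ∃ s < 0,
      (∃ b : EuclideanSpace ℝ (Fin 3), b ≠ 0 ∧ ∀ y, cross (curl (driftProfile s) y) b = 0) ∨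
      (∃ e : EuclideanSpace ℝ (Fin 3), e ≠ 0 ∧
        ∀ (y : EuclideanSpace ℝ (Fin 3)) (l : ℝ), driftProfile s (y + l • e) = driftProfile s y) := by
  rintro ⟨s, hs, ⟨b, hb, hal⟩ | ⟨e, he, htr⟩⟩
  · obtain ⟨y, hy⟩ := vorticityDirection_nonconstant_driftProfile hs b hb
    exact hy (hal y)
  · obtain ⟨y, l, hy⟩ := not_translationInvariant_driftProfile hs e he
    exact hy (htr y l)

end Summit.NavierStokesRegularity.NavierStokesRegularity.Theorems.PoloidalWindowRigidity.Negative

end
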